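import Summits.QuantumFields.YangMills.Theorems.FemtoTransferGapBlockCrossOfDefects
import Summits.QuantumFields.YangMills.Theorems.DressedRitz.Negative.BlockToFineLoadBearing
import HarnessLib

/-!
# Crux `DressedRitz` (stmt-QuantumFields-20205), line «polyakovlift» r9 — the `√δ` RATE of the LEAD's door `BlockToFine.blockCross_of_defects` (p593347) IS SHARP:
# the block cross clause (B6) at `λ²` is NOT a consequence of dressed block defects at `δ = Cλ³` (tightness lemma, two-level witness)

Standing crux disprover `ym-cdisprove-20205-1` g15 (refuter), supporting item stmt-QuantumFields-20205 (no verdict change; negative-side bookkeeping for the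
r9 ∕ r10 design — work file `Cruxes/DressedRitz/Disproof.lean` §19).  The LEAD's by-name alternative p593347 derives the block cross datum from the two
dressed block defects by Cauchy–Schwarz: `|⟨u,K^ℓu'⟩ − ((X̄+X̄')/2)⟨u,u'⟩| ≤ √δ·((X̄+X̄')/2)·‖u‖‖u'‖`, and remarks that at r9's `δ = Cλ³` this gives only `λ^{3/2}`,
one half-power short of (B6)'s `Cλ²λ₀^L`, "which is why r9 keeps (B6) as a clause".  This file certifies that the remark is FORCED, not a weakness of the proof:

* §1–§2 two-level pairings with a pure eigenvector partner, and the pure-real algebra of the witness;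
* §3 ★ `blockCross_of_defects_sharp`: on every lattice `(L, β > 0)` and for every block length `ℓ ≥ 1` and every `δ₀ > 0` there are physical `v, w` meeting ALL
  hypotheses of `blockCross_of_defects` with a common defect level `0 < δ ≤ δ₀` whose symmetrised block cross is `≥ (1/3)·√δ·((X̄+X̄')/2)·‖u‖‖u'‖` — the rate `√δ`
  cannot be replaced by any `o(√δ)`, and the constant is sharp up to a factor `3`.  Witness: an `l2`-orthonormal physical eigenpair `κ₁ > 0`, `0 < κ₂ ≤ κ₁/2`
  (`exists_eigenpair_ratio_le`), `v = ψ₁ + ε•ψ₂` (slightly admixed upper level), `w = ψ₂` (pure lower level): the dressed defect of `v` is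
  `δ = ε²P²Q²(P−Q)²/(P³+ε²Q³)²` (`P = κ₁^ℓ`, `Q = κ₂^ℓ`), that of `w` is `0`, and the symmetrised cross is `εQ²P²(P−Q)/(2‖K^ℓv‖²)` — FIRST order in the
  admixture amplitude `ε`, while the defect is second order;
* §4 ★ `blockCross_sq_not_of_cubic_defects`: consequently, for EVERY pair of constants `C, C' > 0` and all sufficiently small `λ` there are physical `v, w` with both
  dressed block defects `≤ Cλ³` whose symmetrised block cross EXCEEDS `C'λ²·((X̄+X̄')/2)·‖u‖‖u'‖`: no door of the shape «dressed block defects at `λ³` ⟹ (B6) at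
  `λ²`» exists, for any constants.  So in r9 the ∃-basis clause (B6) of `stub_blockPosition` cannot be sourced from `stub_blockLeakage`'s `Cλ³` defect clauses by any
  basis-blind door, and in the r10 option `BlockPlateauForL` (p593581) the (B6) conjunct is not made redundant by its own `Cλ³` defect conjuncts through such a
  door; a supplier wanting (B6) for free from `blockCross_of_defects` must certify dressed block defects at `δ = O(λ⁴)` (the one-loop size), exactly as the LEAD
  wrote.  (Nothing is claimed about the specific dressed lifts: physically their defects ARE `O(λ⁴)` and (B6) holds at the margin `O(λ²)λ₀^L`.)

PHYSICS (why the witness is the generic situation, not a pathology): for the dressed lifts of two DISTINCT one-site levels `i ≠ l` in a common orthonormal trial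
family, the inter-level admixture is antisymmetric to first order, so the symmetrised cross is `≈ (X̄_i − X̄_l)·ε_{il}` — first order in the admixture amplitude
`ε_{il} = O(λ)` — while each block defect is `≈ ε_{il}²(X̄_i − X̄_l)²/X̄² = O(λ⁴)`: Cauchy–Schwarz is saturated (cdisprove g13 `Negative.shear_symmetrised_cross_eq_zero`:
the symmetric shear drops out, only the antisymmetric admixture is seen).
HONEST FRAMING: fixed-lattice linear algebra about a door lemma of a child of the CONDITIONAL reduction route R2b1; no stub is closed or refuted; nothing here
bears on infinite volume, the continuum limit or the Clay gap.  References: M. Reed, B. Simon, Methods IV, Thm. XIII.1 [cite: ReedSimonIV1978, Thm. XIII.1];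
M. Lüscher, NPB 219 (1983) 233 [cite: Luscher1983, §3]; M. Lüscher, U. Wolff, NPB 339 (1990) 222 [cite: LuscherWolff1990].
-/

set_option autoImplicit false

noncomputable section

open MeasureTheory Filter Topology Real
open Literature.MathematicalPhysics.QuantumFieldTheory (GaugeConfig Site gaugeTransform)
open scoped BigOperators

namespace Summit.QuantumFields.YangMills.Theorems.FemtoTransferGap.PolyakovLift.Negative

open Summit.QuantumFields.YangMills.Theorems.FemtoTransferGap
open Summit.QuantumFields.YangMills.Theorems.FemtoTransferGap.PolyakovLift

/-! ## §1 Two-level pairings against a pure eigenvector partner -/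

section TwoLevel

variable {L : ℕ} [NeZero L] (β : ℝ) {ψ₁ ψ₂ : GaugeConfig 3 L SU2 → ℝ} {κ₁ κ₂ : ℝ}

/-- Cross pairing of the dressed mixture with the dressed pure partner: `⟨K^[m](ψ₁ + s•ψ₂), K^[n]ψ₂⟩ = s·κ₂^{m+n}`. [folklore] -/
theorem l2_mixture_iterate_eigen_iterate (h₁ : IsPhys ψ₁) (h₂ : IsPhys ψ₂)
    (he₁ : transferApply β ψ₁ = κ₁ • ψ₁) (he₂ : transferApply β ψ₂ = κ₂ • ψ₂)
    (hn₁ : l2 ψ₁ ψ₁ = 1) (hn₂ : l2 ψ₂ ψ₂ = 1) (h₁₂ : l2 ψ₁ ψ₂ = 0) (s : ℝ) (m n : ℕ) :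
    l2 ((transferApply (L := L) β)^[m] (ψ₁ + s • ψ₂)) ((transferApply β)^[n] ψ₂) = s * κ₂ ^ (m + n) := by
  rw [iterate_transferApply_mixture β h₁ h₂ he₁ he₂ s m, iterate_transferApply_eigen β he₂ n,
    show κ₂ ^ n • ψ₂ = (0 : ℝ) • ψ₁ + κ₂ ^ n • ψ₂ by rw [zero_smul, zero_add],
    l2_twoLevel_pair h₁ h₂ hn₁ hn₂ h₁₂, pow_add]
  ring

/-- Pairings of the dressed pure partner with itself: `⟨K^[m]ψ₂, K^[n]ψ₂⟩ = κ₂^{m+n}`. [folklore] -/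
theorem l2_eigen_iterate_iterate (h₁ : IsPhys ψ₁) (h₂ : IsPhys ψ₂)
    (he₂ : transferApply β ψ₂ = κ₂ • ψ₂)
    (hn₁ : l2 ψ₁ ψ₁ = 1) (hn₂ : l2 ψ₂ ψ₂ = 1) (h₁₂ : l2 ψ₁ ψ₂ = 0) (m n : ℕ) :
    l2 ((transferApply (L := L) β)^[m] ψ₂) ((transferApply β)^[n] ψ₂) = κ₂ ^ (m + n) := by
  rw [iterate_transferApply_eigen β he₂ m, iterate_transferApply_eigen β he₂ n,
    show κ₂ ^ m • ψ₂ = (0 : ℝ) • ψ₁ + κ₂ ^ m • ψ₂ by rw [zero_smul, zero_add],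
    show κ₂ ^ n • ψ₂ = (0 : ℝ) • ψ₁ + κ₂ ^ n • ψ₂ by rw [zero_smul, zero_add],
    l2_twoLevel_pair h₁ h₂ hn₁ hn₂ h₁₂, pow_add]
  ring

end TwoLevel

/-! ## §2 Pure-real algebra of the witness: defect second order, cross first order in the admixture -/

/-- **Two-level cross algebra.**  With `P > 0`, `0 < Q ≤ P/2`, `0 < ε ≤ 2` and `n = P²+ε²Q²` (`‖K^ℓv‖²`), `T = P³+ε²Q³` (`⟨K^ℓv,K^{2ℓ}v⟩`), `R = P⁴+ε²Q⁴`
(`⟨K^ℓv,K^{3ℓ}v⟩`), `δ = (εPQ(P−Q)/T)²`: `R·n = (1+δ)T²` exactly (so `δ` IS the dressed block defect of `v`), `(4/9)ε²(Q(P−Q)/P²)² ≤ δ ≤ ε²(Q(P−Q)/P²)²`, the pure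
partner has defect `0 ≤ δ`, and the symmetrised cross `εQ³ − ((T/n + Q)/2)·εQ²` has modulus `≥ (1/3)·√δ·((T/n+Q)/2)·√n·Q`. [folklore] -/
theorem twoLevelCross_real {P Q ε : ℝ} (hQ : 0 < Q) (hQP : Q ≤ P / 2) (hε : 0 < ε) (hε2 : ε ≤ 2) :
    0 < P ^ 2 + ε ^ 2 * Q ^ 2 ∧ 0 < P ^ 3 + ε ^ 2 * Q ^ 3 ∧
    0 < (ε * P * Q * (P - Q) / (P ^ 3 + ε ^ 2 * Q ^ 3)) ^ 2 ∧
    (ε * P * Q * (P - Q) / (P ^ 3 + ε ^ 2 * Q ^ 3)) ^ 2 ≤ ε ^ 2 * (Q * (P - Q) / P ^ 2) ^ 2 ∧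
    4 / 9 * (ε ^ 2 * (Q * (P - Q) / P ^ 2) ^ 2) ≤ (ε * P * Q * (P - Q) / (P ^ 3 + ε ^ 2 * Q ^ 3)) ^ 2 ∧
    (P ^ 4 + ε ^ 2 * Q ^ 4) * (P ^ 2 + ε ^ 2 * Q ^ 2) =
      (1 + (ε * P * Q * (P - Q) / (P ^ 3 + ε ^ 2 * Q ^ 3)) ^ 2) * (P ^ 3 + ε ^ 2 * Q ^ 3) ^ 2 ∧
    Q ^ 4 * Q ^ 2 ≤ (1 + (ε * P * Q * (P - Q) / (P ^ 3 + ε ^ 2 * Q ^ 3)) ^ 2) * (Q ^ 3) ^ 2 ∧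
    Real.sqrt ((ε * P * Q * (P - Q) / (P ^ 3 + ε ^ 2 * Q ^ 3)) ^ 2) *
        (((P ^ 3 + ε ^ 2 * Q ^ 3) / (P ^ 2 + ε ^ 2 * Q ^ 2) + Q ^ 3 / Q ^ 2) / 2) *
        (Real.sqrt (P ^ 2 + ε ^ 2 * Q ^ 2) * Real.sqrt (Q ^ 2)) ≤
      3 * |ε * Q ^ 3 - ((P ^ 3 + ε ^ 2 * Q ^ 3) / (P ^ 2 + ε ^ 2 * Q ^ 2) + Q ^ 3 / Q ^ 2) / 2 * (ε * Q ^ 2)| := by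
  have hP : 0 < P := by linarith
  have hPQ : 0 < P - Q := by linarith
  have hεQ : ε * Q ≤ P := by nlinarith
  set n := P ^ 2 + ε ^ 2 * Q ^ 2 with hn
  set T := P ^ 3 + ε ^ 2 * Q ^ 3 with hT
  have hn0 : 0 < n := by positivity
  have hT0 : 0 < T := by positivity
  have hP3 : 0 < P ^ 3 := by positivity
  -- T between P³ and (3/2)P³
  have hTlo : P ^ 3 ≤ T := by rw [hT]; nlinarith [pow_pos hQ 3]
  have hTup : T ≤ 3 / 2 * P ^ 3 := by
    have : ε ^ 2 * Q ^ 3 ≤ P ^ 3 / 2 := by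
      have h1 : ε ^ 2 ≤ 4 := by nlinarith
      have h2 : Q ^ 3 ≤ (P / 2) ^ 3 := pow_le_pow_left₀ hQ.le hQP 3
      nlinarith [pow_pos hQ 3]
    rw [hT]; linarith
  -- the defect
  set a := ε * P * Q * (P - Q) with ha
  have ha0 : 0 < a := by positivity
  have hδ0 : 0 < (a / T) ^ 2 := by positivity
  have hsδ : Real.sqrt ((a / T) ^ 2) = a / T := Real.sqrt_sq (by positivity)
  have hsQ : Real.sqrt (Q ^ 2) = Q := Real.sqrt_sq hQ.le
  set s := Real.sqrt n with hs
  have hs0 : 0 ≤ s := Real.sqrt_nonneg _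
  have hs2 : s * s = n := Real.mul_self_sqrt hn0.le
  have hs32 : s ≤ 3 / 2 * P := by
    rw [hs, Real.sqrt_le_left (by positivity)]
    rw [hn]; nlinarith [mul_self_le_mul_self (by positivity : 0 ≤ ε * Q) hεQ]
  refine ⟨hn0, hT0, hδ0, ?_, ?_, ?_, ?_, ?_⟩
  · -- δ ≤ ε²(Q(P−Q)/P²)²  ⟸  P³ ≤ T
    rw [div_pow, div_pow, ← mul_div_assoc, div_le_div_iff₀ (by positivity) (by positivity)]
    have h6 : (P ^ 3) ^ 2 ≤ T ^ 2 := pow_le_pow_left₀ hP3.le hTlo 2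
    have : a ^ 2 * (P ^ 2) ^ 2 = ε ^ 2 * (Q * (P - Q)) ^ 2 * (P ^ 3) ^ 2 := by rw [ha]; ring
    rw [this]
    exact mul_le_mul_of_nonneg_left h6 (by positivity)
  · -- (4/9)ε²(Q(P−Q)/P²)² ≤ δ  ⟸  T ≤ (3/2)P³
    rw [div_pow, div_pow, ← mul_div_assoc, ← mul_div_assoc, div_le_div_iff₀ (by positivity) (by positivity)]
    have h6 : T ^ 2 ≤ (3 / 2 * P ^ 3) ^ 2 := pow_le_pow_left₀ hT0.le hTup 2
    have : a ^ 2 * (P ^ 2) ^ 2 = ε ^ 2 * (Q * (P - Q)) ^ 2 * (P ^ 3) ^ 2 := by rw [ha]; ring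
    rw [this]
    nlinarith [mul_le_mul_of_nonneg_left h6 (by positivity : 0 ≤ 4 / 9 * (ε ^ 2 * (Q * (P - Q)) ^ 2))]
  · -- R·n = (1+δ)T²
    rw [div_pow]; field_simp; rw [ha, hn, hT]; ring
  · -- pure partner: Q⁶ ≤ (1+δ)Q⁶
    have : Q ^ 4 * Q ^ 2 = 1 * (Q ^ 3) ^ 2 := by ring
    rw [this]
    exact mul_le_mul_of_nonneg_right (by linarith) (by positivity)
  · -- the cross saturates √δ up to a factor 3
    rw [hsδ, hsQ]
    have hX : T / n + Q ^ 3 / Q ^ 2 = (T + Q * n) / n := by field_simp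
    rw [hX]
    have hy : ε * Q ^ 3 - (T + Q * n) / n / 2 * (ε * Q ^ 2) = -(ε * Q ^ 2 * (T - Q * n) / (2 * n)) := by field_simp; ring
    have hTQn : T - Q * n = P ^ 2 * (P - Q) := by rw [hT, hn]; ring
    rw [hy, abs_neg, abs_of_pos (by rw [hTQn]; positivity)]
    -- (T + Qn)·s ≤ 3PT
    have hQn : Q * n ≤ T := by nlinarith
    have key : (T + Q * n) * s ≤ 3 * P * T := by nlinarith [mul_le_mul (by linarith : T + Q * n ≤ 2 * T) hs32 hs0 (by positivity)]
    have lhs : a / T * ((T + Q * n) / n / 2) * (s * Q) = (ε * Q ^ 2 * P * (P - Q) / (2 * n)) * ((T + Q * n) * s / T) := by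
      rw [ha]; field_simp
    have rhs : 3 * (ε * Q ^ 2 * (T - Q * n) / (2 * n)) = (ε * Q ^ 2 * P * (P - Q) / (2 * n)) * (3 * P) := by
      rw [hTQn]; field_simp
    rw [lhs, rhs]
    refine mul_le_mul_of_nonneg_left ?_ (by positivity)
    rw [div_le_iff₀ hT0]
    linarith

/-! ## §3 ★ The physical witness: `blockCross_of_defects` is saturated up to a factor `3` at arbitrarily small defect level -/

section Witness

variable {L : ℕ} [NeZero L]

/-- **Master witness.**  On every lattice `(L, β > 0)` and for every block length `ℓ ≥ 1` there are `l2`-orthonormal physical `ψ₁, ψ₂` (an exact eigenpair of `K_β`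
with `0 < κ₂ ≤ κ₁/2`) and an amplitude `A > 0` (`A = Q(P−Q)/P²`, `P = κ₁^ℓ`, `Q = κ₂^ℓ`) such that for every admixture `0 < ε ≤ 2` the pair `v = ψ₁ + ε•ψ₂`, `w = ψ₂`
meets ALL hypotheses of `BlockToFine.blockCross_of_defects` with the common defect level `δ`, `(4/9)ε²A² ≤ δ ≤ ε²A²`, and its symmetrised block cross is
`≥ (1/3)·√δ·((X̄+X̄')/2)·‖K^ℓv‖‖K^ℓw‖`. [folklore] -/
theorem blockCross_witness {β : ℝ} (hβ : 0 < β) {ℓ : ℕ} (hℓ : 1 ≤ ℓ) :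
    ∃ (ψ₁ ψ₂ : GaugeConfig 3 L SU2 → ℝ) (A : ℝ), IsPhys ψ₁ ∧ IsPhys ψ₂ ∧ 0 < A ∧
      ∀ ε : ℝ, 0 < ε → ε ≤ 2 → ∃ δ : ℝ, 0 < δ ∧ 4 / 9 * (ε ^ 2 * A ^ 2) ≤ δ ∧ δ ≤ ε ^ 2 * A ^ 2 ∧
        0 < l2 ((transferApply β)^[ℓ] (ψ₁ + ε • ψ₂)) ((transferApply β)^[ℓ] (ψ₁ + ε • ψ₂)) ∧
        0 < l2 ((transferApply β)^[ℓ] ψ₂) ((transferApply β)^[ℓ] ψ₂) ∧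
        0 < l2 ((transferApply β)^[ℓ] (ψ₁ + ε • ψ₂)) ((transferApply β)^[2 * ℓ] (ψ₁ + ε • ψ₂)) ∧
        0 < l2 ((transferApply β)^[ℓ] ψ₂) ((transferApply β)^[2 * ℓ] ψ₂) ∧
        l2 ((transferApply β)^[ℓ] (ψ₁ + ε • ψ₂)) ((transferApply β)^[3 * ℓ] (ψ₁ + ε • ψ₂)) *
            l2 ((transferApply β)^[ℓ] (ψ₁ + ε • ψ₂)) ((transferApply β)^[ℓ] (ψ₁ + ε • ψ₂)) ≤
          (1 + δ) * l2 ((transferApply β)^[ℓ] (ψ₁ + ε • ψ₂)) ((transferApply β)^[2 * ℓ] (ψ₁ + ε • ψ₂)) ^ 2 ∧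
        l2 ((transferApply β)^[ℓ] ψ₂) ((transferApply β)^[3 * ℓ] ψ₂) * l2 ((transferApply β)^[ℓ] ψ₂) ((transferApply β)^[ℓ] ψ₂) ≤
          (1 + δ) * l2 ((transferApply β)^[ℓ] ψ₂) ((transferApply β)^[2 * ℓ] ψ₂) ^ 2 ∧
        Real.sqrt δ *
            ((l2 ((transferApply β)^[ℓ] (ψ₁ + ε • ψ₂)) ((transferApply β)^[2 * ℓ] (ψ₁ + ε • ψ₂)) /
                  l2 ((transferApply β)^[ℓ] (ψ₁ + ε • ψ₂)) ((transferApply β)^[ℓ] (ψ₁ + ε • ψ₂)) +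
                l2 ((transferApply β)^[ℓ] ψ₂) ((transferApply β)^[2 * ℓ] ψ₂) / l2 ((transferApply β)^[ℓ] ψ₂) ((transferApply β)^[ℓ] ψ₂)) / 2) *
            (Real.sqrt (l2 ((transferApply β)^[ℓ] (ψ₁ + ε • ψ₂)) ((transferApply β)^[ℓ] (ψ₁ + ε • ψ₂))) *
              Real.sqrt (l2 ((transferApply β)^[ℓ] ψ₂) ((transferApply β)^[ℓ] ψ₂))) ≤
          3 * |l2 ((transferApply β)^[ℓ] (ψ₁ + ε • ψ₂)) ((transferApply β)^[2 * ℓ] ψ₂) -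
              (l2 ((transferApply β)^[ℓ] (ψ₁ + ε • ψ₂)) ((transferApply β)^[2 * ℓ] (ψ₁ + ε • ψ₂)) /
                    l2 ((transferApply β)^[ℓ] (ψ₁ + ε • ψ₂)) ((transferApply β)^[ℓ] (ψ₁ + ε • ψ₂)) +
                  l2 ((transferApply β)^[ℓ] ψ₂) ((transferApply β)^[2 * ℓ] ψ₂) / l2 ((transferApply β)^[ℓ] ψ₂) ((transferApply β)^[ℓ] ψ₂)) / 2 *
                l2 ((transferApply β)^[ℓ] (ψ₁ + ε • ψ₂)) ((transferApply β)^[ℓ] ψ₂)| := by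
  obtain ⟨ψ₁, ψ₂, κ₁, κ₂, h₁, h₂, hn₁, hn₂, h₁₂, he₁, he₂, hκ₁, hκ₂, hle⟩ :=
    exists_eigenpair_ratio_le (L := L) hβ (ρ := 1 / 2) (by norm_num) (by norm_num)
  have hP : 0 < κ₁ ^ ℓ := pow_pos hκ₁ ℓ
  have hQ : 0 < κ₂ ^ ℓ := pow_pos hκ₂ ℓ
  have hQP : κ₂ ^ ℓ ≤ κ₁ ^ ℓ / 2 := by
    have h1 : κ₂ ^ ℓ ≤ (κ₁ / 2) ^ ℓ := pow_le_pow_left₀ hκ₂.le (by linarith) ℓ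
    have h2 : (κ₁ / 2) ^ ℓ = κ₁ ^ ℓ / 2 ^ ℓ := by rw [div_pow]
    have h3 : (2 : ℝ) ≤ 2 ^ ℓ := by
      calc (2 : ℝ) = 2 ^ 1 := by norm_num
        _ ≤ 2 ^ ℓ := pow_le_pow_right₀ (by norm_num) hℓ
    have h4 : κ₁ ^ ℓ / 2 ^ ℓ ≤ κ₁ ^ ℓ / 2 := div_le_div_of_nonneg_left hP.le (by norm_num) h3
    linarith [h2 ▸ h1]
  refine ⟨ψ₁, ψ₂, κ₂ ^ ℓ * (κ₁ ^ ℓ - κ₂ ^ ℓ) / (κ₁ ^ ℓ) ^ 2, h₁, h₂, by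
    have : 0 < κ₁ ^ ℓ - κ₂ ^ ℓ := by linarith
    positivity, ?_⟩
  intro ε hε hε2
  -- exponent bookkeeping
  have p2 : ∀ κ : ℝ, κ ^ (ℓ + ℓ) = (κ ^ ℓ) ^ 2 := fun κ => by rw [← pow_mul, show ℓ * 2 = ℓ + ℓ by ring]
  have p3 : ∀ κ : ℝ, κ ^ (ℓ + 2 * ℓ) = (κ ^ ℓ) ^ 3 := fun κ => by rw [← pow_mul, show ℓ * 3 = ℓ + 2 * ℓ by ring]
  have p4 : ∀ κ : ℝ, κ ^ (ℓ + 3 * ℓ) = (κ ^ ℓ) ^ 4 := fun κ => by rw [← pow_mul, show ℓ * 4 = ℓ + 3 * ℓ by ring]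
  -- the eight pairings
  have e1 : l2 ((transferApply β)^[ℓ] (ψ₁ + ε • ψ₂)) ((transferApply β)^[ℓ] (ψ₁ + ε • ψ₂)) = (κ₁ ^ ℓ) ^ 2 + ε ^ 2 * (κ₂ ^ ℓ) ^ 2 := by
    rw [l2_mixture_iterate_iterate β h₁ h₂ he₁ he₂ hn₁ hn₂ h₁₂, p2, p2]
  have e2 : l2 ((transferApply β)^[ℓ] (ψ₁ + ε • ψ₂)) ((transferApply β)^[2 * ℓ] (ψ₁ + ε • ψ₂)) = (κ₁ ^ ℓ) ^ 3 + ε ^ 2 * (κ₂ ^ ℓ) ^ 3 := by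
    rw [l2_mixture_iterate_iterate β h₁ h₂ he₁ he₂ hn₁ hn₂ h₁₂, p3, p3]
  have e3 : l2 ((transferApply β)^[ℓ] (ψ₁ + ε • ψ₂)) ((transferApply β)^[3 * ℓ] (ψ₁ + ε • ψ₂)) = (κ₁ ^ ℓ) ^ 4 + ε ^ 2 * (κ₂ ^ ℓ) ^ 4 := by
    rw [l2_mixture_iterate_iterate β h₁ h₂ he₁ he₂ hn₁ hn₂ h₁₂, p4, p4]
  have f1 : l2 ((transferApply β)^[ℓ] ψ₂) ((transferApply β)^[ℓ] ψ₂) = (κ₂ ^ ℓ) ^ 2 := by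
    rw [l2_eigen_iterate_iterate β h₁ h₂ he₂ hn₁ hn₂ h₁₂, p2]
  have f2 : l2 ((transferApply β)^[ℓ] ψ₂) ((transferApply β)^[2 * ℓ] ψ₂) = (κ₂ ^ ℓ) ^ 3 := by
    rw [l2_eigen_iterate_iterate β h₁ h₂ he₂ hn₁ hn₂ h₁₂, p3]
  have f3 : l2 ((transferApply β)^[ℓ] ψ₂) ((transferApply β)^[3 * ℓ] ψ₂) = (κ₂ ^ ℓ) ^ 4 := by
    rw [l2_eigen_iterate_iterate β h₁ h₂ he₂ hn₁ hn₂ h₁₂, p4]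
  have c1 : l2 ((transferApply β)^[ℓ] (ψ₁ + ε • ψ₂)) ((transferApply β)^[2 * ℓ] ψ₂) = ε * (κ₂ ^ ℓ) ^ 3 := by
    rw [l2_mixture_iterate_eigen_iterate β h₁ h₂ he₁ he₂ hn₁ hn₂ h₁₂, p3]
  have c2 : l2 ((transferApply β)^[ℓ] (ψ₁ + ε • ψ₂)) ((transferApply β)^[ℓ] ψ₂) = ε * (κ₂ ^ ℓ) ^ 2 := by
    rw [l2_mixture_iterate_eigen_iterate β h₁ h₂ he₁ he₂ hn₁ hn₂ h₁₂, p2]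
  obtain ⟨hn0, hT0, hδ0, hδup, hδlo, hRn, hw, hcross⟩ := twoLevelCross_real hQ hQP hε hε2
  refine ⟨_, hδ0, ?_, ?_, ?_, ?_, ?_, ?_, ?_, ?_, ?_⟩
  · simpa [mul_pow] using hδlo
  · simpa [mul_pow] using hδup
  · rw [e1]; exact hn0
  · rw [f1]; positivity
  · rw [e2]; exact hT0
  · rw [f2]; positivity
  · rw [e3, e1, e2]; exact hRn.le
  · rw [f3, f1, f2]; exact hw
  · rw [c1, c2, e2, e1, f2, f1]; exact hcross

/-- ★ **`BlockToFine.blockCross_of_defects` (p593347) is SHARP: the `√δ` rate is attained, up to a factor `3`, at arbitrarily small defect level.**  For every lattice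
`(L, β > 0)`, block length `ℓ ≥ 1` and `δ₀ > 0` there are physical `v, w` satisfying every hypothesis of the door with a common dressed-block-defect level
`0 < δ ≤ δ₀`, whose symmetrised block cross is `≥ (1/3)·√δ·((X̄+X̄')/2)·‖K^ℓv‖‖K^ℓw‖`.  Hence no bound `o(√δ)·((X̄+X̄')/2)·‖u‖‖u'‖` — in particular none of order
`δ^{2/3}`, which is what (B6) at `λ²` from defects at `λ³` would need — can hold.  Witness: `v = ψ₁ + ε•ψ₂`, `w = ψ₂` over an exact physical eigenpair.
[cite: ReedSimonIV1978, Thm. XIII.1] -/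
theorem blockCross_of_defects_sharp {β : ℝ} (hβ : 0 < β) {ℓ : ℕ} (hℓ : 1 ≤ ℓ) {δ₀ : ℝ} (hδ₀ : 0 < δ₀) :
    ∃ (v w : GaugeConfig 3 L SU2 → ℝ) (δ : ℝ), IsPhys v ∧ IsPhys w ∧ 0 < δ ∧ δ ≤ δ₀ ∧
      0 < l2 ((transferApply β)^[ℓ] v) ((transferApply β)^[ℓ] v) ∧
      0 < l2 ((transferApply β)^[ℓ] w) ((transferApply β)^[ℓ] w) ∧
      0 < l2 ((transferApply β)^[ℓ] v) ((transferApply β)^[2 * ℓ] v) ∧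
      0 < l2 ((transferApply β)^[ℓ] w) ((transferApply β)^[2 * ℓ] w) ∧
      l2 ((transferApply β)^[ℓ] v) ((transferApply β)^[3 * ℓ] v) * l2 ((transferApply β)^[ℓ] v) ((transferApply β)^[ℓ] v) ≤
        (1 + δ) * l2 ((transferApply β)^[ℓ] v) ((transferApply β)^[2 * ℓ] v) ^ 2 ∧
      l2 ((transferApply β)^[ℓ] w) ((transferApply β)^[3 * ℓ] w) * l2 ((transferApply β)^[ℓ] w) ((transferApply β)^[ℓ] w) ≤
        (1 + δ) * l2 ((transferApply β)^[ℓ] w) ((transferApply β)^[2 * ℓ] w) ^ 2 ∧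
      Real.sqrt δ *
          ((l2 ((transferApply β)^[ℓ] v) ((transferApply β)^[2 * ℓ] v) / l2 ((transferApply β)^[ℓ] v) ((transferApply β)^[ℓ] v) +
              l2 ((transferApply β)^[ℓ] w) ((transferApply β)^[2 * ℓ] w) / l2 ((transferApply β)^[ℓ] w) ((transferApply β)^[ℓ] w)) / 2) *
          (Real.sqrt (l2 ((transferApply β)^[ℓ] v) ((transferApply β)^[ℓ] v)) * Real.sqrt (l2 ((transferApply β)^[ℓ] w) ((transferApply β)^[ℓ] w))) ≤
        3 * |l2 ((transferApply β)^[ℓ] v) ((transferApply β)^[2 * ℓ] w) -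
            (l2 ((transferApply β)^[ℓ] v) ((transferApply β)^[2 * ℓ] v) / l2 ((transferApply β)^[ℓ] v) ((transferApply β)^[ℓ] v) +
                l2 ((transferApply β)^[ℓ] w) ((transferApply β)^[2 * ℓ] w) / l2 ((transferApply β)^[ℓ] w) ((transferApply β)^[ℓ] w)) / 2 *
              l2 ((transferApply β)^[ℓ] v) ((transferApply β)^[ℓ] w)| := by
  obtain ⟨ψ₁, ψ₂, A, h₁, h₂, hA, hall⟩ := blockCross_witness (L := L) hβ hℓ
  set ε := min 1 (δ₀ / A ^ 2) with hεdef
  have hε : 0 < ε := lt_min one_pos (by positivity)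
  have hε1 : ε ≤ 1 := min_le_left _ _
  have hεA : ε ≤ δ₀ / A ^ 2 := min_le_right _ _
  obtain ⟨δ, hδ0, -, hδup, hposv, hposw, hTv, hTw, hdv, hdw, hcross⟩ := hall ε hε (by linarith)
  refine ⟨ψ₁ + ε • ψ₂, ψ₂, δ, h₁.add (h₂.smul ε), h₂, hδ0, ?_, hposv, hposw, hTv, hTw, hdv, hdw, hcross⟩
  have hA2 : 0 < A ^ 2 := by positivity
  have h1 : ε ^ 2 * A ^ 2 ≤ ε * (δ₀ / A ^ 2) * A ^ 2 := by
    have : ε ^ 2 ≤ ε * (δ₀ / A ^ 2) := by rw [sq]; exact mul_le_mul_of_nonneg_left hεA hε.le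
    exact mul_le_mul_of_nonneg_right this hA2.le
  have h2 : ε * (δ₀ / A ^ 2) * A ^ 2 = ε * δ₀ := by field_simp
  nlinarith

end Witness

/-! ## §4 ★ No door «dressed block defects at `λ³` ⟹ (B6) at `λ²`», for any constants -/

section NoCubicDoor

variable {L : ℕ} [NeZero L]

/-- ★ **(B6) at `λ²` is NOT a consequence of dressed block defects at `Cλ³` — for EVERY pair of constants `C, C' > 0`.**  On every lattice `(L, β > 0)` and
for every block length `ℓ ≥ 1` there is `λ₁ > 0` such that for EVERY `0 < λ ≤ λ₁` some physical `v, w` (meeting the positivity hypotheses of the door) have both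
dressed block defects `≤ Cλ³` while their symmetrised block cross EXCEEDS `C'λ²·((X̄+X̄')/2)·‖K^ℓv‖‖K^ℓw‖`.  (Witness of §3 with `ε² = Cλ³/A²`; `λ₁ =
min(1, 4A²/C, C/(25C'²))`.)  So r9's ∃-basis clause (B6) (`stub_blockPosition`, p588721) cannot be sourced from the `Cλ³` defect clauses of
`stub_blockLeakage` (p586831) by any basis-blind door, the (B6) conjunct of the r10 text `BlockPlateauForL` (p593581) is not made redundant by its `Cλ³` defect
conjuncts through such a door, and a supplier wanting (B6) from `blockCross_of_defects` must certify dressed block defects at `δ = O(λ⁴)` (about the specific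
dressed lifts nothing is claimed). [cite: ReedSimonIV1978, Thm. XIII.1] [cite: Luscher1983, §3] -/
theorem blockCross_sq_not_of_cubic_defects {β : ℝ} (hβ : 0 < β) {ℓ : ℕ} (hℓ : 1 ≤ ℓ) {C C' : ℝ} (hC : 0 < C) (hC' : 0 < C') :
    ∃ lam1 : ℝ, 0 < lam1 ∧ ∀ lam : ℝ, 0 < lam → lam ≤ lam1 →
      ∃ (v w : GaugeConfig 3 L SU2 → ℝ), IsPhys v ∧ IsPhys w ∧
        0 < l2 ((transferApply β)^[ℓ] v) ((transferApply β)^[ℓ] v) ∧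
        0 < l2 ((transferApply β)^[ℓ] w) ((transferApply β)^[ℓ] w) ∧
        0 < l2 ((transferApply β)^[ℓ] v) ((transferApply β)^[2 * ℓ] v) ∧
        0 < l2 ((transferApply β)^[ℓ] w) ((transferApply β)^[2 * ℓ] w) ∧
        l2 ((transferApply β)^[ℓ] v) ((transferApply β)^[3 * ℓ] v) * l2 ((transferApply β)^[ℓ] v) ((transferApply β)^[ℓ] v) ≤
          (1 + C * lam ^ 3) * l2 ((transferApply β)^[ℓ] v) ((transferApply β)^[2 * ℓ] v) ^ 2 ∧
        l2 ((transferApply β)^[ℓ] w) ((transferApply β)^[3 * ℓ] w) * l2 ((transferApply β)^[ℓ] w) ((transferApply β)^[ℓ] w) ≤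
          (1 + C * lam ^ 3) * l2 ((transferApply β)^[ℓ] w) ((transferApply β)^[2 * ℓ] w) ^ 2 ∧
        C' * lam ^ 2 *
            ((l2 ((transferApply β)^[ℓ] v) ((transferApply β)^[2 * ℓ] v) / l2 ((transferApply β)^[ℓ] v) ((transferApply β)^[ℓ] v) +
                l2 ((transferApply β)^[ℓ] w) ((transferApply β)^[2 * ℓ] w) / l2 ((transferApply β)^[ℓ] w) ((transferApply β)^[ℓ] w)) / 2) *
            (Real.sqrt (l2 ((transferApply β)^[ℓ] v) ((transferApply β)^[ℓ] v)) * Real.sqrt (l2 ((transferApply β)^[ℓ] w) ((transferApply β)^[ℓ] w))) <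
          |l2 ((transferApply β)^[ℓ] v) ((transferApply β)^[2 * ℓ] w) -
              (l2 ((transferApply β)^[ℓ] v) ((transferApply β)^[2 * ℓ] v) / l2 ((transferApply β)^[ℓ] v) ((transferApply β)^[ℓ] v) +
                  l2 ((transferApply β)^[ℓ] w) ((transferApply β)^[2 * ℓ] w) / l2 ((transferApply β)^[ℓ] w) ((transferApply β)^[ℓ] w)) / 2 *
                l2 ((transferApply β)^[ℓ] v) ((transferApply β)^[ℓ] w)| := by
  obtain ⟨ψ₁, ψ₂, A, h₁, h₂, hA, hall⟩ := blockCross_witness (L := L) hβ hℓ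
  have hA2 : 0 < A ^ 2 := by positivity
  refine ⟨min 1 (min (4 * A ^ 2 / C) (C / (25 * C' ^ 2))), lt_min one_pos (lt_min (by positivity) (by positivity)), ?_⟩
  intro lam hlam hlam1
  have hl1 : lam ≤ 1 := le_trans hlam1 (min_le_left _ _)
  have hl2 : lam ≤ 4 * A ^ 2 / C := le_trans hlam1 (le_trans (min_le_right _ _) (min_le_left _ _))
  have hl3 : lam ≤ C / (25 * C' ^ 2) := le_trans hlam1 (le_trans (min_le_right _ _) (min_le_right _ _))
  -- the admixture amplitude ε with ε²A² = Cλ³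
  have hCl : 0 < C * lam ^ 3 := by positivity
  set ε := Real.sqrt (C * lam ^ 3) / A with hεdef
  have hε : 0 < ε := by rw [hεdef]; exact div_pos (Real.sqrt_pos.2 hCl) hA
  have hε2A : ε ^ 2 * A ^ 2 = C * lam ^ 3 := by
    rw [hεdef, div_pow, Real.sq_sqrt hCl.le]; field_simp
  have hl33 : lam ^ 3 ≤ lam := by
    have : lam ^ 3 = lam * (lam * lam) := by ring
    rw [this]; nlinarith [mul_le_one₀ hl1 hlam.le hl1]
  have hCl4 : C * lam ^ 3 ≤ 4 * A ^ 2 := by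
    have h1 : C * lam ^ 3 ≤ C * lam := mul_le_mul_of_nonneg_left hl33 hC.le
    have h2 : C * lam ≤ C * (4 * A ^ 2 / C) := mul_le_mul_of_nonneg_left hl2 hC.le
    have h3 : C * (4 * A ^ 2 / C) = 4 * A ^ 2 := by field_simp
    linarith
  have hε2 : ε ≤ 2 := by
    have hsq : ε ^ 2 ≤ 4 := by nlinarith
    nlinarith
  obtain ⟨δ, hδ0, hδlo, hδup, hposv, hposw, hTv, hTw, hdv, hdw, hcross⟩ := hall ε hε hε2
  have hδC : δ ≤ C * lam ^ 3 := hε2A ▸ hδup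
  refine ⟨ψ₁ + ε • ψ₂, ψ₂, h₁.add (h₂.smul ε), h₂, hposv, hposw, hTv, hTw, ?_, ?_, ?_⟩
  · exact hdv.trans (mul_le_mul_of_nonneg_right (by linarith) (sq_nonneg _))
  · exact hdw.trans (mul_le_mul_of_nonneg_right (by linarith) (sq_nonneg _))
  · -- 3C'λ² < √((4/9)Cλ³) ≤ √δ, then the factor-3 saturation
    have hlow : 4 / 9 * (C * lam ^ 3) ≤ δ := hε2A ▸ hδlo
    have hs1 : Real.sqrt (4 / 9 * (C * lam ^ 3)) ≤ Real.sqrt δ := Real.sqrt_le_sqrt hlow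
    have hs2 : 3 * C' * lam ^ 2 < Real.sqrt (4 / 9 * (C * lam ^ 3)) := by
      rw [Real.lt_sqrt (by positivity)]
      -- (3C'λ²)² = 9C'²λ⁴ < (4/9)Cλ³  ⟸  81C'²λ < 4C  ⟸  25C'²λ ≤ C
      have h25 : 25 * C' ^ 2 * lam ≤ C := by
        have := mul_le_mul_of_nonneg_left hl3 (by positivity : (0:ℝ) ≤ 25 * C' ^ 2)
        rwa [mul_div_cancel₀ _ (by positivity : (25:ℝ) * C' ^ 2 ≠ 0)] at this
      have hl3pos : 0 < lam ^ 3 := by positivity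
      nlinarith [mul_lt_mul_of_pos_right (show 81 * C' ^ 2 * lam < 4 * C by nlinarith) hl3pos]
    -- M > 0
    set M := (l2 ((transferApply β)^[ℓ] (ψ₁ + ε • ψ₂)) ((transferApply β)^[2 * ℓ] (ψ₁ + ε • ψ₂)) /
          l2 ((transferApply β)^[ℓ] (ψ₁ + ε • ψ₂)) ((transferApply β)^[ℓ] (ψ₁ + ε • ψ₂)) +
        l2 ((transferApply β)^[ℓ] ψ₂) ((transferApply β)^[2 * ℓ] ψ₂) / l2 ((transferApply β)^[ℓ] ψ₂) ((transferApply β)^[ℓ] ψ₂)) / 2 *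
      (Real.sqrt (l2 ((transferApply β)^[ℓ] (ψ₁ + ε • ψ₂)) ((transferApply β)^[ℓ] (ψ₁ + ε • ψ₂))) *
        Real.sqrt (l2 ((transferApply β)^[ℓ] ψ₂) ((transferApply β)^[ℓ] ψ₂))) with hMdef
    have hM : 0 < M := by
      rw [hMdef]
      have := div_pos hTv hposv
      have := div_pos hTw hposw
      have := Real.sqrt_pos.2 hposv
      have := Real.sqrt_pos.2 hposw
      positivity
    have hcross' : Real.sqrt δ * M ≤ 3 * |l2 ((transferApply β)^[ℓ] (ψ₁ + ε • ψ₂)) ((transferApply β)^[2 * ℓ] ψ₂) -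
        (l2 ((transferApply β)^[ℓ] (ψ₁ + ε • ψ₂)) ((transferApply β)^[2 * ℓ] (ψ₁ + ε • ψ₂)) /
              l2 ((transferApply β)^[ℓ] (ψ₁ + ε • ψ₂)) ((transferApply β)^[ℓ] (ψ₁ + ε • ψ₂)) +
            l2 ((transferApply β)^[ℓ] ψ₂) ((transferApply β)^[2 * ℓ] ψ₂) / l2 ((transferApply β)^[ℓ] ψ₂) ((transferApply β)^[ℓ] ψ₂)) / 2 *
          l2 ((transferApply β)^[ℓ] (ψ₁ + ε • ψ₂)) ((transferApply β)^[ℓ] ψ₂)| := by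
      rw [hMdef, ← mul_assoc]; exact hcross
    have hlt : 3 * C' * lam ^ 2 * M < Real.sqrt δ * M := mul_lt_mul_of_pos_right (hs2.trans_le hs1) hM
    have hshape : C' * lam ^ 2 *
        ((l2 ((transferApply β)^[ℓ] (ψ₁ + ε • ψ₂)) ((transferApply β)^[2 * ℓ] (ψ₁ + ε • ψ₂)) /
              l2 ((transferApply β)^[ℓ] (ψ₁ + ε • ψ₂)) ((transferApply β)^[ℓ] (ψ₁ + ε • ψ₂)) +
            l2 ((transferApply β)^[ℓ] ψ₂) ((transferApply β)^[2 * ℓ] ψ₂) / l2 ((transferApply β)^[ℓ] ψ₂) ((transferApply β)^[ℓ] ψ₂)) / 2) *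
        (Real.sqrt (l2 ((transferApply β)^[ℓ] (ψ₁ + ε • ψ₂)) ((transferApply β)^[ℓ] (ψ₁ + ε • ψ₂))) *
          Real.sqrt (l2 ((transferApply β)^[ℓ] ψ₂) ((transferApply β)^[ℓ] ψ₂))) = C' * lam ^ 2 * M := by
      rw [hMdef]; ring
    rw [hshape]
    linarith
end NoCubicDoor

end Summit.QuantumFields.YangMills.Theorems.FemtoTransferGap.PolyakovLift.Negative

end
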